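import Summits.BirchSwinnertonDyer.BirchSwinnertonDyer.Theorems.AlignedTransportAtTwoMainConjectureTransportAlignedAtTwoNegTwistMeasure
import HarnessLib

/-!
# Route `AlignedTransportAtTwo`, crux C1 `MainConjectureTransportAlignedAtTwo` (stmt-BirchSwinnertonDyer-22296), line `birth` — NEGATIVE
# twists, transform level: `L₂(g, χ(2)α) = C(c)·(1+T)^{−f_m}·L₂(f, m, α, 𝟙_m) + C(2c)·ι(E)`, `E ∈ Λ`, from a Birch relation UP TO INTEGERS
# (the limit of the finite-level comparison of `…NegTwistMeasure.lean`)

HONEST FRAMING (cell `bsd-f1-sign2`, lead seat `bsd-line-att-p1` g7). BSD is NOT proved; C1 is NOT closed. THEOREMS ONLY; nothing asserted;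
`--supports stmt-BirchSwinnertonDyer-22296 --as helper`. Continuation of `…NegTwistMeasure.lean` (§1 measure level, §2 the `η = 1` half-sum
comparison and the Δ-doubling of the translated `𝟙_m`-weighted tame sum):

* §3 **`exists_padicLFunction_twist_eq_add_two_mul`** — passing to the limit (`tendsto_riemannSum_translate` for the `𝟙_m`-weighted tame measure
  translated by `m`, exactly as in the tree's `padicLCoeff_twist_eq`; the slack stays in the closed ball `2c·ℤ₂`):
  `L₂(g, χ(2)α) = C(c)·(1+T)^{−f_m}·L₂(f, m, α, 𝟙_m) + C(2c)·ι(E)` for some `E ∈ Λ = ℤ₂⟦T⟧` — i.e. the `2`-adic `L`-function of the ODD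
  twist is congruent mod `2c·Λ` to `C(c)·(1+T)^{−f_m}` times the `m`-DEPLETED plus `2`-adic `L`-function of `f`.

Downstream (`…NegTwistCongruence.lean`): with the tree's depletion half `exists_iwasawa_padicLFunctionTame_one_congr_two_auto`
(`L₂(f,m,α,𝟙_m) ≡ u·L₂(f,α)·∏𝒫_ℓ (mod 2)`) this is the `d < 0` twin of the cell `bsd-2adic` congruence `exists_iwasawa_twist_congr_two_and_sq`.

References: [MazurTateTeitelbaum1986Invent] §I.8, §I.10 (10.1), §I.13; [Matsuno2000] Lemmas 3.2–3.3 and proof of Thm. 3.1 (pp. 86–88).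
-/

set_option autoImplicit false
set_option linter.dupNamespace false

noncomputable section

open scoped Classical MatrixGroups ModularForm

open CongruenceSubgroup Filter Topology PowerSeries
open Literature.NumberTheory.EllipticCurves Literature.NumberTheory.EllipticCurves.ModularForms
  Literature.NumberTheory.EllipticCurves.GreenbergVatsal2000
open Summit.BirchSwinnertonDyer.BirchSwinnertonDyer.Theorems.AlignedTransportAtTwoNegTwistMeasure

namespace Summit.BirchSwinnertonDyer.BirchSwinnertonDyer.Theorems.AlignedTransportAtTwoNegTwistTransform

/-! ## §3 The transform congruence -/

section Transform

variable {N N' : ℕ} [NeZero N] [NeZero N'] (f : CuspForm (Gamma0 N) 2) (g : CuspForm (Gamma0 N') 2)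
  {m : ℕ} [NeZero m]

/-- **THE ODD-TWIST TRANSFORM CONGRUENCE (rhombic shortcut).** Let `f ∈ S₂(Γ₀(N))` be a rational normalised newform of odd level, `(m, 2N) = 1`,
`α ∈ ℚ₂` a root of `X² − a₂(f)X + 2` with `‖α‖ = 1`, `χ` a `ℚ`-valued character mod `m` with `χ(2)² = 1` and `χ(b)² = 1` on units, `c ∈ ℚ`,
and `g` a weight-`2` form whose plus symbols satisfy Birch's relation UP TO INTEGERS `[x]⁺_g = c·(Σ_b χ(b)[x + b/m]⁺_f + k_x)` at every `x` of
denominator prime to `N`, and whose `2`-adic Riemann sums at `χ(2)α` converge (`hTg`). Then there is `E ∈ Λ = ℤ₂⟦T⟧` with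
`L₂(g, χ(2)α, T) = C(c)·(1+T)^{−f_m}·L₂(f, m, α, 𝟙_m, T) + C(2c)·ι(E)` — i.e. `L₂(g) ≡ C(c)·(1+T)^{−f_m}·(m-DEPLETED L₂(f)) (mod 2c·Λ)`,
`f_m = frobeniusExponent 2 m`. Limit of §2 (`tendsto_riemannSum_translate` for the `𝟙_m`-weighted tame measure translated by `m`; the slack stays
in the closed ball). [cite: MazurTateTeitelbaum1986Invent, §I.8–I.13 (pp. 10–19)] [cite: Matsuno2000, Lemmas 3.2–3.3 and proof of Thm. 3.1 (pp. 86–88)] -/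
theorem exists_padicLFunction_twist_eq_add_two_mul (hf : IsNewform0 f) (hQ : coeffField f = ⊥) (h2N : ¬ 2 ∣ N)
    (hm2 : m.Coprime 2) (hmN : m.Coprime N) {a₂ : ℤ} (ha₂ : cuspCoeff f 2 = a₂) {α : ℚ_[2]}
    (hroot : α ^ 2 - a₂ * α + 2 = 0) (hαu : ‖α‖ = 1) (χ : MulChar (ZMod m) ℚ) (hχ2 : χ (2 : ZMod m) ^ 2 = 1)
    (hχv : ∀ b : ZMod m, IsUnit b → χ b ^ 2 = 1) {c : ℚ}
    (hBk : ∀ x : ℚ, Nat.Coprime x.den N →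
      ∃ k : ℤ, ratPlusSymbol g x = c * (∑ b : ZMod m, χ b * ratPlusSymbol f (x + (b.val : ℚ) / m) + k))
    (hTg : ∀ k : ℕ, Tendsto (padicLRiemannSum g (((χ (2 : ZMod m) : ℚ) : ℚ_[2]) * α) k) atTop
      (𝓝 (padicLCoeff g (((χ (2 : ZMod m) : ℚ) : ℚ_[2]) * α) k))) :
    ∃ E : IwasawaAlgebra 2, padicLFunction g (((χ (2 : ZMod m) : ℚ) : ℚ_[2]) * α) =
      C (c : ℚ_[2]) * PowerSeries.binomialSeries ℚ_[2] (-frobeniusExponent 2 (m : ℤ_[2])) *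
        padicLFunctionTame f m α (1 : DirichletCharacter ℚ_[2] m) +
      C (2 * c : ℚ_[2]) * iwasawaToPowerSeries 2 E := by
  classical
  set α' : ℚ_[2] := ((χ (2 : ZMod m) : ℚ) : ℚ_[2]) * α with hα'def
  have hreal : ∀ n, (cuspCoeff f n).im = 0 := cuspCoeff_im_eq_zero_of_coeffField_eq_bot hQ
  have hα0 : α ≠ 0 := norm_ne_zero_iff.mp (by rw [hαu]; exact one_ne_zero)
  have hα : ‖α⁻¹‖ ≤ 1 := by rw [norm_inv, hαu, inv_one]
  set χ₁ : DirichletCharacter ℚ_[2] m := 1 with hχ₁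
  -- the translated `𝟙_m`-weighted tame Riemann sums and their limit (as in the tree's `padicLCoeff_twist_eq`)
  have hdist := sum_filter_weighted_msdMeasureTame_succ f hf (fun r ↦ ratCast_ratPlusSymbol_holds hf hQ r) h2N hm2 ha₂ hα0
    hroot χ₁
  obtain ⟨Cb, hCb⟩ := exists_norm_weighted_msdMeasureTame_le f
    (exists_nsmul_modularSymbol_mem_periodLattice_of_isNewform0 hf hQ) hαu χ₁
  obtain ⟨teich, hc⟩ := exists_teichmuller_frobeniusExponent 2 hm2
  have hRSdef : ∀ k n : ℕ, padicLRiemannSumTame f m α χ₁ k n =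
      ∑ᶠ zz : rootsOfUnity (torsionOrder 2) ℤ_[2], ∑ s : ZMod (2 ^ n),
        (fun (n : ℕ) (a : ZMod (2 ^ n)) ↦ ∑ b : ZMod m, χ₁ b * msdMeasureTame f m α n a b)
          (n + cyclotomicExponent 2)
          (PadicInt.toZModPow (n + cyclotomicExponent 2) ((zz : ℤ_[2]ˣ) : ℤ_[2]) *
            (cyclotomicGenerator 2 : ZMod (2 ^ (n + cyclotomicExponent 2))) ^ s.val) *
          (s.val.choose k : ℚ_[2]) :=
    fun k n ↦ padicLRiemannSumTame_eq_sum_weighted f α χ₁ k n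
  set RSz : ℕ → ℕ → ℚ_[2] := fun k n ↦ ∑ᶠ zz : rootsOfUnity (torsionOrder 2) ℤ_[2], ∑ s : ZMod (2 ^ n),
        (fun (n : ℕ) (a : ZMod (2 ^ n)) ↦ ∑ b : ZMod m, χ₁ b * msdMeasureTame f m α n a b)
          (n + cyclotomicExponent 2)
          ((PadicInt.toZModPow (n + cyclotomicExponent 2) ((teich : ℤ_[2]ˣ) : ℤ_[2]) *
              (cyclotomicGenerator 2 : ZMod (2 ^ (n + cyclotomicExponent 2))) ^
                (PadicInt.toZModPow n (frobeniusExponent 2 (m : ℤ_[2]))).val) *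
            (PadicInt.toZModPow (n + cyclotomicExponent 2) ((zz : ℤ_[2]ˣ) : ℤ_[2]) *
              (cyclotomicGenerator 2 : ZMod (2 ^ (n + cyclotomicExponent 2))) ^ s.val)) *
          ((s.val.choose k : ℕ) : ℚ_[2]) with hRSz_def
  have hRSz : ∀ k n : ℕ, RSz k n = ∑ᶠ zz : rootsOfUnity (torsionOrder 2) ℤ_[2], ∑ s : ZMod (2 ^ n),
        (fun (n : ℕ) (a : ZMod (2 ^ n)) ↦ ∑ b : ZMod m, χ₁ b * msdMeasureTame f m α n a b)
          (n + cyclotomicExponent 2)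
          ((PadicInt.toZModPow (n + cyclotomicExponent 2) ((teich : ℤ_[2]ˣ) : ℤ_[2]) *
              (cyclotomicGenerator 2 : ZMod (2 ^ (n + cyclotomicExponent 2))) ^
                (PadicInt.toZModPow n (frobeniusExponent 2 (m : ℤ_[2]))).val) *
            (PadicInt.toZModPow (n + cyclotomicExponent 2) ((zz : ℤ_[2]ˣ) : ℤ_[2]) *
              (cyclotomicGenerator 2 : ZMod (2 ^ (n + cyclotomicExponent 2))) ^ s.val)) *
          ((s.val.choose k : ℕ) : ℚ_[2]) := fun k n ↦ by rw [hRSz_def]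
  -- the limit `ℓ_k` of the translated sums
  set ℓ : ℕ → ℚ_[2] := fun k ↦ ∑ i ∈ Finset.range (k + 1),
      algebraMap ℤ_[2] ℚ_[2] (Ring.choose (-frobeniusExponent 2 (m : ℤ_[2])) (k - i)) *
        limUnder atTop (fun n ↦ padicLRiemannSumTame f m α χ₁ i n) with hℓ
  have hlim : ∀ k, Tendsto (fun n ↦ RSz k n) atTop (𝓝 (ℓ k)) := fun k ↦ tendsto_riemannSum_translate hdist hCb hRSdef hRSz k
  -- the finite-level comparison `‖R_g − c·RSz‖ ≤ ‖2c‖`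
  have hbound : ∀ k n, ‖padicLRiemannSum g α' k n - (c : ℚ_[2]) * RSz k n‖ ≤ ‖(2 * c : ℚ_[2])‖ := by
    intro k n
    have h1 := norm_padicLRiemannSum_twist_sub_half_le f g hf hreal h2N hm2 hmN ha₂ hα hroot χ hχ2 hχv hBk k n
    have h2 := translatedRiemannSumTame_one_two_eq f hm2 α hc k n
    have hR : (c : ℚ_[2]) * RSz k n = 2 * (c : ℚ_[2]) * ∑ s : ZMod (2 ^ n), (∑ b : ZMod m, (1 : DirichletCharacter ℚ_[2] m) b *
        msdMeasureTame f m α (n + 2) ((cyclotomicGenerator 2 : ZMod (2 ^ (n + 2))) ^ s.val * (m : ZMod (2 ^ (n + 2)))) b) *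
        (s.val.choose k : ℚ_[2]) := by
      rw [hRSz, hχ₁, h2]; ring
    rw [hR]
    exact h1
  -- pass to the limit
  set D : ℕ → ℚ_[2] := fun k ↦ padicLCoeff g α' k - (c : ℚ_[2]) * ℓ k with hD
  have hDlim : ∀ k, Tendsto (fun n ↦ padicLRiemannSum g α' k n - (c : ℚ_[2]) * RSz k n) atTop (𝓝 (D k)) :=
    fun k ↦ (hTg k).sub ((hlim k).const_mul (c : ℚ_[2]))
  have hDn : ∀ k, ‖D k‖ ≤ ‖(2 * c : ℚ_[2])‖ :=
    fun k ↦ le_of_tendsto' ((hDlim k).norm) fun n ↦ hbound k n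
  by_cases hc0 : c = 0
  · -- degenerate constant: everything on the right vanishes and `L₂(g) = 0` coefficientwise
    refine ⟨0, ?_⟩
    ext k
    have h : D k = padicLCoeff g α' k := by rw [hD, hc0]; simp
    have h0 : ‖padicLCoeff g α' k‖ ≤ 0 := by
      have := hDn k; rw [h, hc0] at this; simpa using this
    rw [coeff_padicLFunction, norm_le_zero_iff.mp h0, hc0]
    simp
  · -- `E_k = D_k/(2c)`, `‖E_k‖ ≤ 1`
    have h2c : (2 * c : ℚ_[2]) ≠ 0 := mul_ne_zero two_ne_zero (by exact_mod_cast hc0)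
    obtain ⟨E, hE⟩ := (exists_iwasawaToPowerSeries_eq_iff_norm_coeff_le_one (p := 2)
      (PowerSeries.mk fun k ↦ D k / (2 * c : ℚ_[2]))).mpr fun k ↦ by
        rw [PowerSeries.coeff_mk, norm_div, div_le_one (norm_pos_iff.mpr h2c)]
        exact hDn k
    refine ⟨E, ?_⟩
    have hmd : ∀ x : ℚ_[2], (2 * c : ℚ_[2]) * (x / (2 * c)) = x := fun x ↦ by field_simp
    have hℓ' : ∀ k, (c : ℚ_[2]) * ℓ k = (c : ℚ_[2]) * ∑ i ∈ Finset.range (k + 1),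
        algebraMap ℤ_[2] ℚ_[2] (Ring.choose (-frobeniusExponent 2 (m : ℤ_[2])) (k - i)) *
          coeff i (padicLFunctionTame f m α (1 : DirichletCharacter ℚ_[2] m)) := by
      intro k
      rw [hℓ]
      congr 1
      refine Finset.sum_congr rfl fun i _ ↦ ?_
      rw [coeff_padicLFunctionTame, hχ₁]
      rfl
    ext k
    rw [map_add, coeff_padicLFunction, coeff_C_mul_binomialSeries_mul, PowerSeries.coeff_C_mul, hE, PowerSeries.coeff_mk, hmd,
      hD]
    simp only
    rw [hℓ']
    ring

end Transform

end Summit.BirchSwinnertonDyer.BirchSwinnertonDyer.Theorems.AlignedTransportAtTwoNegTwistTransform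

end
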